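import Literature.MathematicalPhysics.QuantumFieldTheory.Balaban1983to89.B9Eq375Composition

/-!
# `Balaban1983to89.B9Eq372Operator` — B9, p. 405: the word «OPERATOR» in «It is a local, bounded operator satisfying the bound (3.72)»,
# «The operator V₁ satisfies (3.73)» and «where the operators F_{2,k}(A), V₂(A) satisfy the bounds (3.72), (3.73)» MADE HONEST for the
# four objects typed pointwise in `B9Eq371Composition` ((3.71): `F₁`, `V₁`) and `B9Eq375Composition` ((3.75): `F₂`, `V₂`): ℂ-LINEARITY in
# the argument `A′`, the four maps as (continuous) linear operators on the space of vector fields, (3.71)/(3.75) as OPERATOR IDENTITIES,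
# and «bounded» as OPERATOR-NORM bounds for the sup norm (3.39) on a finite lattice, with explicit constants — general transport size `ρ`
# and the printed scale (3.37); v1.1
# (v1 = p192240; v1.1 docstring only: the operator of (3.71) is `D*_UD_U` = `lapDD` — v1's docstrings misnamed it `D_UR(U)D*_U`,
# which is the operator of (3.76); no declaration, statement or proof changed)

CITATION HEADER (lean-in-tree rule).  Audit cell `pub-balaban`, surge node-prover lineage pv27 (B9 pp. 390–392, 396–397, 404–405),
unit `b2b-balaban-pv27-g19` (journal CLAIM l.58192, node B9-EQ372-OPERATOR; third node of the seat, after B9-EQ375-COMPOSITION =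
`B9Eq375Composition` (p191250/p191719) — the only import; it re-exports `B9Eq371Composition` (p190758, unit `…-g17`) — and B9-EQ375-LOCALITY =
`B9Eq375Locality` (p191610/p191722), not imported).  Source: T. Bałaban, *Propagators for lattice gauge theories in a background field*,
Commun. Math. Phys. **99** (1985) 389–434 [Balaban1985BackgroundPropagators] (cell paper B9; journal page = PDF page + 388), p. 405
[PDF 17] ((3.71)–(3.75) and the three «operator» sentences), with (3.37) p. 396 [PDF 8], (3.39) p. 397 [PDF 9] and the norm remark of
p. 390 [PDF 2], quoted from the page renders `b2b-balaban-ref1/pages/1985-cmp99-background-propagators/…-p002-x2.png`, `…-p008-x2.png`,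
`…-p009-x2.png`, `…-p017-x2.png` READ AS IMAGES by this seat (2026-08-19).  The verbatim transcriptions of (3.71) and (3.75) are in the
headers of `B9Eq371Composition` and `B9Eq375Composition` (imported BY NAME); they are not repeated here.

HONEST FRAMING (cell charter, verbatim in substance).  The cell audits Bałaban's papers; discharging its end statements would
make Bałaban's ultraviolet stability theorem unconditional inside this package — a constructive-QFT statement; it is NOT the
continuum limit and NOT the Clay problem.  THIS FILE DISCHARGES NOTHING of the series: it is linear-algebra bookkeeping on the
lineage's lattice carrier (`B9Eq39Adjoint`: `R W X = WXW⁻¹`, `covD = D¹ = ηD`, `covDstar = D¹*`, `curl`, `prodCfg U η A = (b ↦ e^{iηA(b)}·U(b))`),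
consuming BY NAME the pointwise closed forms and estimates of `B9Eq371Composition` (`lapDD`, `sBracket`, `curlE₁`, `curlE₂`, `fRem`,
`F₁op`, `V₁op`, `lapDD_prodCfg`, `norm_F₁op_le`, `norm_V₁op_le`, `norm_F₁op_le_printed`, `norm_V₁op_le_printed`, `norm_R_le_sq`) and of
`B9Eq375Composition` (`gradDiv`, `sBracket₂`, `divE₁`, `divE₂`, `fRem₂`, `F₂op`, `V₂op`, `gradDiv_prodCfg`, `norm_F₂op_le`, `norm_V₂op_le`,
`norm_F₂op_le_printed`, `norm_V₂op_le_printed`), the additivity/homogeneity lemmas of `B9Eq39Adjoint` (`R_add`, `R_smul`, `covD_add`,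
`covD_smul`, `covDstar_add`, `covDstar_smul`, `curl_smul`) and of `B9Eq310Hermitian` (`curl_add`, in the import cone), `B9Eq370Expansion.conjRem`, the commutator `ad` of `Beta.BackgroundVertices`
(`ad_add_right`, `ad_smul_right`), `B9Eq369Product.prodCfg_zero`, and Mathlib's `LinearMap`/`ContinuousLinearMap`/operator norm.  Value =
kernel certificate that the four maps `A′ ↦ F₁(A)A′, V₁(A)A′, F₂(A)A′, V₂(A)A′` ARE linear operators (the pointwise files never say so),
that (3.71)/(3.75) hold as identities between operators, and that the printed pointwise bounds (3.72)/(3.73) integrate to operator-norm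
bounds `‖F(A)‖ ≤ C_F(d, η, ρ, |A|)`, `‖V(A)‖ ≤ C_V(d, η, ρ, |A|, |∇A|)` on the sup-normed space of vector fields over a finite lattice, with
the constants written out.  NOT summit progress.

ABSOLUTE RULE.  No internally-minted statement enters as a cited fact.  Every declaration below is PROVED (tags `[folklore]`);
the `[cite: …]` tags document WHICH PRINTED CLAUSE a definition or a proved statement transcribes — the proofs are ours, the
print is not used as a hypothesis anywhere.  The regularity input (3.37) enters the four `_printed` corollaries as HYPOTHESES on
the exponent field (`‖A(b)‖ ≤ a ≤ α₁(L^jη)⁻¹`, `‖(D¹A)‖ ≤ g ≤ η·α₁(L^jη)⁻²`) with `α₁ ≥ 0`, `L ≥ 1`, `η > 0`, `j` as binders.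

LETTERS AND NORMALISATION (as `B9Eq371Composition`/`B9Eq375Composition`): `A` = exponent field of `U′ = e^{iηA}U`, `A′` = the argument;
`D¹ = covD = ηD`, `D¹* = covDstar = ηD*`; every operator is `η²` × the printed one (so the printed `O(1)α₁²(L^jη)⁻²` of (3.72) appears as
`O(1)α₁²L^{−2j}`).  THE SPACE: vector fields `A′ : ι → S → 𝔸` (direction, initial site of the bond) with the Pi sup norm, which for
finite `ι`, `S` is the print's `|A′| = max_μ sup_x |A′_μ(x)|` of (3.39); the gradient seminorm `|∇A′| = max_{μ,ν} sup_x |(D_μA′_ν)(x)|` of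
(3.39) is, in the `η`-normalisation, dominated by `(ρ² + 1)|A′|` (`norm_covD_le_pi`), which is how it is absorbed in the operator-norm
form of (3.73).

WHAT IS IN PRINT («…» verbatim from the renders).  p. 405 [PDF 17], between (3.71) and (3.74): «The operator F_{1,k} is defined
similarly to F′_{1,k} by taking the remainder of the expansion R(U′) = exp ηiad_A = 1 + ηiad_A + ⋯ in the expressions above. It is a
local, bounded operator satisfying the bound |(F_{1,k}(A)A′)_μ(x)| ≤ O(1)|A|²|A′| ≤ O(1)α₁²(L^jη)⁻²|A′|, b ∈ Ω_j (3.72) with the same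
norms |A|, |A′| determined by the set st(b) as in (3.69). The operator V₁ satisfies |(V₁(A)A′)(b)| ≤ O(1)(|A||∇A′| + |∇A||A′| + |A|²|A′|)
≤ O(1)α₁((L^jη)⁻¹|∇A′| + (L^jη)⁻²|A′|), b ∈ Ω_j, (3.73) with the same conditions on norms as above. The derivatives are, of course, the
covariant derivatives defined by U. The constant O(1) is an absolute constant depending on d only.»; after (3.75): «where the
operators F_{2,k}(A), V₂(A) satisfy the bounds (3.72), (3.73).»  (3.39), p. 397: «|A| = max_μ sup_x |A_μ(x)|, |∇A| = max_{μ,ν} sup_x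
|(D_μA_ν)(x)|»; (3.37), p. 396: «|A′| < α₁(L^jη)⁻¹, |∇^η_U A′| < α₁(L^jη)⁻² on Ω_j, j = 0, …, k;»; p. 390: «Let us remark only that in
this paper a norm |X| of a N × N matrix means the Hilbert–Schmidt norm: |X|² = tr X*X.»  READING.  «operator» = the map `A′ ↦ (b ↦
(F_{1,k}(A)A′)(b))` (resp. `V₁(A)`, `F_{2,k}(A)`, `V₂(A)`) on 𝔤^c-valued vector fields, `A` (hence `U′U`) FIXED; the print uses, but never
states, that these maps are LINEAR in `A′` ((3.71)/(3.75) are expansions of the linear operators `D*_{U′U}D_{U′U}`,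
`D_{U′U}D*_{U′U}` in `A`, so every term is linear in `A′` by construction); «bounded» = the displayed sup-norm inequalities.  This file
proves the linearity from the typed closed forms (it is not definitionally visible: `fRem`, `fRem₂` contain `e^{iηA}A′e^{−iηA} − A′ −
iη[A, A′]` and products of transports of `U′U`), packages the maps as elements of `End_ℂ` and — on a finite lattice — of the normed
algebra of bounded operators, and turns the pointwise bounds into operator-norm bounds.

WHAT THIS FILE PROVES.  MODEL (as in the lineage leaves): `𝔸` a complete normed ℂ-algebra; sites `S`, directions `ι`; shifts
`T ν : S ≃ S` (NO commutation assumed), background `U : ι → S → 𝔸ˣ` (ARBITRARY units), `A`, `A′`, `B′ : ι → S → 𝔸`, `c : ℂ`.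
* §1 LINEARITY IN `A′`, pointwise at every bond (no finiteness except `[Fintype ι]` where `Σ_ν` occurs): `conjRem_add_right`,
  `conjRem_smul_right` (`X ↦ e^bXe^{−b} − X − [b, X]`), `curl_add_fun`, `curl_smul_fun` (`curl_add` is `B9Eq310Hermitian.curl_add`, used BY NAME); family (3.71): **`sBracket_add/_smul`**,
  `curlE₁_add/_smul`, `curlE₂_add/_smul` (+ `_fun`), **`fRem_add/_smul`**, **`F₁op_add/_smul`**, **`V₁op_add/_smul`**, `lapDD_add/_smul`,
  **`V₁op_eq_lapDD_sub`** (`V₁(A)A′ = D*_UD_UA′ − D*_{U′U}D_{U′U}A′`, (3.71) solved for `V₁`); family (3.75): `divE₁_add/_smul`,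
  `divE₂_add/_smul` (+ `_fun`), **`sBracket₂_add/_smul`**, **`fRem₂_add/_smul`**, **`F₂op_add/_smul`**, **`V₂op_add/_smul`**, `gradDiv_add/_smul`,
  **`V₂op_eq_gradDiv_sub`**.
* §2 THE OPERATORS as ℂ-linear maps of `ι → S → 𝔸` (`[Fintype ι]`): **`lapDDlin`** (`D*_UD_U` of (3.71), i.e. `lapDD`), **`gradDivlin`**
  (`D_UD*_U` of (3.75)), **`F₁lin`**, **`V₁lin`**, **`F₂lin`**, **`V₂lin`** (+ `_apply`); **`lapDDlin_prodCfg`** — (3.71) as an identity in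
  `End_ℂ`: `lapDDlin(U′U) = lapDDlin(U) − V₁lin(A)`; **`gradDivlin_prodCfg`** — (3.75) likewise; `V₁lin_eq_sub`, `V₂lin_eq_sub` (the
  perturbations ARE the differences of the unperturbed and perturbed operators).
* §3 CONTINUITY AND THE BOUNDED-OPERATOR PACKAGING (product topology; `[Fintype ι]`): `continuous_sBracket`, `continuous_curlE₁/₂`,
  `continuous_fRem`, `continuous_F₁op_apply`, `continuous_V₁op_apply`, `continuous_lapDD_apply`, their (3.75) analogues, `continuous_F₁op`,
  …, `continuous_gradDiv`; the continuous linear operators **`lapDDL`**, **`gradDivL`**, **`F₁L`**, **`V₁L`**, **`F₂L`**, **`V₂L`** (+ `_apply`),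
  **`lapDDL_prodCfg`**, **`gradDivL_prodCfg`** ((3.71)/(3.75) between continuous operators), `V₂L_zero` (`V₂(0) = 0`, via `prodCfg_zero`).
* §4 «BOUNDED»: OPERATOR NORMS (`[Fintype ι] [Fintype S]`, sup norm (3.39); transport size `‖U(b)‖, ‖U(b)⁻¹‖ ≤ ρ`, `ρ ≥ 1`, uniform as
  in (3.35); `‖A(b)‖ ≤ a`, `‖(D¹_κA_τ)(z)‖ ≤ g`, `a, g ≥ 0`; `s = ηρ²a`, `d = |ι|`): `norm_apply_le_pi`, **`norm_covD_le_pi`** (`‖(D¹_κA′_τ)(z)‖ ≤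
  (ρ² + 1)‖A′‖`), `pi_norm_le_of_forall₂`; the constants **`CF c d η ρ a`** `= d·c·ρ⁴s²e^{2s}(3 + 2s + s²e^{2s})` (`c = 8` for `F₁`, `4` for
  `F₂`), **`CV₁`** `= d·η((8ρ² + 4)a(ρ² + 1) + 2ρ²(1 + ρ²)g) + CF 8`, **`CV₂`** `= d·η((4ρ⁴ + 2ρ² + 2)a(ρ² + 1) + 2ρ²(1 + ρ² + ρ⁴)g) + CF 4`
  (`_nonneg`); (3.72) as operator bounds: **`norm_F₁L_apply_le`**/**`opNorm_F₁L_le`** (`‖F₁(A)A′‖ ≤ CF 8·‖A′‖`, `‖F₁(A)‖ ≤ CF 8 d η ρ a`),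
  **`norm_F₂L_apply_le`**/**`opNorm_F₂L_le`** (`CF 4`); (3.73) as operator bounds: **`norm_V₁L_apply_le`**/**`opNorm_V₁L_le`** (`‖V₁(A)‖ ≤ CV₁ d η
  ρ a g`), **`norm_V₂L_apply_le`**/**`opNorm_V₂L_le`** (`CV₂`) — the printed `|A||∇A′|` term absorbed by `|∇A′| ≤ (ρ² + 1)|A′|`; at the
  PRINTED SCALE (`ρ = 1`, (3.37) on `A`): **`opNorm_F₁L_le_printed`** `‖F₁(A)‖ ≤ d·8e^{2α₁}(3 + 2α₁ + α₁²e^{2α₁})·α₁²·L^{−2j}` and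
  **`opNorm_F₂L_le_printed`** (`4` for `8`) — (3.72), second inequality, in operator norm (×`η²`); **`opNorm_V₁L_le_printed`** `‖V₁(A)‖ ≤
  d·4α₁·[6L^{−j} + (1 + 2α₁e^{2α₁}(3 + 2α₁ + α₁²e^{2α₁}))L^{−2j}]`, **`opNorm_V₂L_le_printed`** `‖V₂(A)‖ ≤ d·α₁·[16L^{−j} + (6 + 4α₁e^{2α₁}(3 +
  2α₁ + α₁²e^{2α₁}))L^{−2j}]` — (3.73), second inequality with `|∇A′| ≤ 2|A′|` (×`η²`; the printed mixed form, which keeps `|∇A′|`, is the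
  pointwise theorem `norm_V₁op_le_printed`/`norm_V₂op_le_printed` of the imported files).
* §5 SANITY (`example`s): additivity of `V₂L`; (3.71) applied to a vector field through `lapDDL_prodCfg`; the operator-norm bound
  consumed as `‖F₂(A)A′‖ ≤ ‖F₂(A)‖‖A′‖ ≤ CF 4·‖A′‖` (`ContinuousLinearMap.le_of_opNorm_le`); `V₂(0) = 0`.

RELATED IN THE TREE, NOT DUPLICATED (searched 2026-08-19: MODULE-MAP rows B9/B12/Beta; `grep -rn "→L\[ℂ\]\|→ₗ\[ℂ\]\|opNorm\|lapDD\|gradDiv"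
Balaban1983to89/`): `B9Eq371Composition`/`B9Eq375Composition` type `F₁, V₁, F₂, V₂` as bare functions of `(A, A′)` and prove (3.72)/(3.73)
POINTWISE with uniform sups — linearity in `A′`, the operator packaging and operator norms are listed nowhere; `B9Eq372Locality`/
`B9Eq375Locality` prove the locality clause (dependence sets) — orthogonal to this file and not imported; `B9Eq39Adjoint` uses `𝔸 →ₗ[ℂ] ℂ`
only for the trace functional.  No file of the directory puts a B9 §3 operator into `End_ℂ`/`→L[ℂ]` or bounds an operator norm of one.

NOT PROVED HERE, NOT CLAIMED: the domain geometry `b ∈ Ω_j` and the scale map `j(b)` (the scale-`j` constants are binders, uniform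
over the lattice: the operator-norm statements are GLOBAL-sup statements, the print's are local to `Ω_j`); infinite lattices (the operator
norm needs `[Fintype S]`; §§1–3 do not); the weighted `L²`/Hilbert–Schmidt operator norms of B9 §1 (p. 392; cell DIVERGENCE D-1) — only the
sup norm (3.39) is treated; sharpness of any constant; the locality clause (see `B9Eq372Locality`, `B9Eq375Locality`); (3.76)/(3.68)
(`P(U′U)`, `P′(A)`, `P₁(A)`) and after.  Records: GAPS C-pv27-77 (modelling divergences as in D-pv27.10; no new divergence).  NOT summit
progress.
-/

noncomputable section

namespace Literature.MathematicalPhysics.QuantumFieldTheory.Balaban1983to89.B9Eq372Operator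

open NormedSpace Complex
open Literature.MathematicalPhysics.QuantumFieldTheory.Balaban1983to89
open Literature.MathematicalPhysics.QuantumFieldTheory.Balaban1983to89.Beta.BackgroundVertices (ad ad_add_right ad_smul_right)
open Literature.MathematicalPhysics.QuantumFieldTheory.Balaban1983to89.B9Eq39Adjoint
open Literature.MathematicalPhysics.QuantumFieldTheory.Balaban1983to89.B9Eq310Hermitian (curl_add)
open Literature.MathematicalPhysics.QuantumFieldTheory.Balaban1983to89.B9Eq369Product
open Literature.MathematicalPhysics.QuantumFieldTheory.Balaban1983to89.B9Eq370Expansion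
open Literature.MathematicalPhysics.QuantumFieldTheory.Balaban1983to89.B9Eq371Composition
open Literature.MathematicalPhysics.QuantumFieldTheory.Balaban1983to89.B9Eq375Composition

section Letters

variable {𝔸 : Type*} [NormedRing 𝔸] [NormedAlgebra ℂ 𝔸] [CompleteSpace 𝔸] {S : Type*} {ι : Type*}
variable (T : ι → Equiv.Perm S) (U : ι → S → 𝔸ˣ)

omit [NormedAlgebra ℂ 𝔸] [CompleteSpace 𝔸] in
/-- The conjugation remainder `X ↦ e^bXe^{−b} − X − [b, X]` (`B9Eq370Expansion.conjRem`) is additive. [folklore] -/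
theorem conjRem_add_right (b X Y : 𝔸) : conjRem b (X + Y) = conjRem b X + conjRem b Y := by
  simp only [conjRem, ad_add_right, mul_add, add_mul]
  abel

omit [CompleteSpace 𝔸] in
/-- … and commutes with complex scalars. [folklore] -/
theorem conjRem_smul_right (b : 𝔸) (c : ℂ) (X : 𝔸) : conjRem b (c • X) = c • conjRem b X := by
  simp only [conjRem, ad_smul_right, mul_smul_comm, smul_mul_assoc, smul_sub]

omit [NormedAlgebra ℂ 𝔸] [CompleteSpace 𝔸] in
/-- `B9Eq310Hermitian.curl_add` as an identity of site functions. [folklore] -/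
theorem curl_add_fun (A' B' : ι → S → 𝔸) (μ ν : ι) :
    curl T U (A' + B') μ ν = curl T U A' μ ν + curl T U B' μ ν := by
  funext x; simp only [curl_add, Pi.add_apply]

omit [CompleteSpace 𝔸] in
/-- `B9Eq39Adjoint.curl_smul` as an identity of site functions. [folklore] -/
theorem curl_smul_fun (c : ℂ) (A' : ι → S → 𝔸) (μ ν : ι) :
    curl T U (c • A') μ ν = c • curl T U A' μ ν := by
  funext x; simp only [curl_smul, Pi.smul_apply]

/-! sBracket -/

omit [CompleteSpace 𝔸] in
/-- The first-order bracket of (3.71) (direction-`ν` summand, `B9Eq371Composition.sBracket`) is additive in `A′`. [folklore]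
[cite: Balaban1985BackgroundPropagators, (3.71) p.405] -/
theorem sBracket_add (η : ℝ) (A A' B' : ι → S → 𝔸) (ν μ : ι) (x : S) :
    sBracket T U η A (A' + B') ν μ x = sBracket T U η A A' ν μ x + sBracket T U η A B' ν μ x := by
  simp only [sBracket, Pi.add_apply, curl_add_fun, covD_add, covDstar_add, R_add, ad_add_right]
  abel

omit [CompleteSpace 𝔸] in
/-- … and ℂ-homogeneous in `A′`. [folklore] [cite: Balaban1985BackgroundPropagators, (3.71) p.405] -/
theorem sBracket_smul (η : ℝ) (A : ι → S → 𝔸) (c : ℂ) (A' : ι → S → 𝔸) (ν μ : ι) (x : S) :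
    sBracket T U η A (c • A') ν μ x = c • sBracket T U η A A' ν μ x := by
  simp only [sBracket, Pi.smul_apply, curl_smul_fun, covD_smul, covDstar_smul, R_smul, ad_smul_right, smul_add,
    smul_sub]

/-! curlE -/

omit [CompleteSpace 𝔸] in
/-- The first-order piece `curlE₁` of the expansion of `D¹_{U′U}` in `A` is additive in `A′`. [folklore] -/
theorem curlE₁_add (η : ℝ) (A A' B' : ι → S → 𝔸) (ν μ : ι) (z : S) :
    curlE₁ T U η A (A' + B') ν μ z = curlE₁ T U η A A' ν μ z + curlE₁ T U η A B' ν μ z := by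
  simp only [curlE₁, Pi.add_apply, R_add, ad_add_right]
  abel

omit [CompleteSpace 𝔸] in
/-- … and ℂ-homogeneous. [folklore] -/
theorem curlE₁_smul (η : ℝ) (A : ι → S → 𝔸) (c : ℂ) (A' : ι → S → 𝔸) (ν μ : ι) (z : S) :
    curlE₁ T U η A (c • A') ν μ z = c • curlE₁ T U η A A' ν μ z := by
  simp only [curlE₁, Pi.smul_apply, R_smul, ad_smul_right, smul_sub]

omit [CompleteSpace 𝔸] in
/-- The all-order remainder piece `curlE₂` (built on `conjRem`) is additive in `A′`. [folklore] -/
theorem curlE₂_add (η : ℝ) (A A' B' : ι → S → 𝔸) (ν μ : ι) (z : S) :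
    curlE₂ T U η A (A' + B') ν μ z = curlE₂ T U η A A' ν μ z + curlE₂ T U η A B' ν μ z := by
  simp only [curlE₂, Pi.add_apply, R_add, conjRem_add_right]
  abel

omit [CompleteSpace 𝔸] in
/-- … and ℂ-homogeneous. [folklore] -/
theorem curlE₂_smul (η : ℝ) (A : ι → S → 𝔸) (c : ℂ) (A' : ι → S → 𝔸) (ν μ : ι) (z : S) :
    curlE₂ T U η A (c • A') ν μ z = c • curlE₂ T U η A A' ν μ z := by
  simp only [curlE₂, Pi.smul_apply, R_smul, conjRem_smul_right, smul_sub]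

omit [CompleteSpace 𝔸] in
/-- `curlE₂_add` as an identity of site functions. [folklore] -/
theorem curlE₂_add_fun (η : ℝ) (A A' B' : ι → S → 𝔸) (ν μ : ι) :
    curlE₂ T U η A (A' + B') ν μ = curlE₂ T U η A A' ν μ + curlE₂ T U η A B' ν μ := by
  funext z; simp only [curlE₂_add, Pi.add_apply]

omit [CompleteSpace 𝔸] in
/-- `curlE₂_smul` as an identity of site functions. [folklore] -/
theorem curlE₂_smul_fun (η : ℝ) (A : ι → S → 𝔸) (c : ℂ) (A' : ι → S → 𝔸) (ν μ : ι) :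
    curlE₂ T U η A (c • A') ν μ = c • curlE₂ T U η A A' ν μ := by
  funext z; simp only [curlE₂_smul, Pi.smul_apply]

/-! fRem -/

/-- The direction-`ν` summand `fRem` of `F_{1,k}(A)A′` («taking the remainder of the expansion R(U′) = exp ηiad_A = 1 + ηiad_A + ⋯»)
is additive in `A′` — not definitionally visible (it contains `e^{iηA}(·)e^{−iηA}` remainders and transports of `U′U`). [folklore]
[cite: Balaban1985BackgroundPropagators, p.405 («The operator F_{1,k}»)] -/
theorem fRem_add (η : ℝ) (A A' B' : ι → S → 𝔸) (ν μ : ι) (x : S) :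
    fRem T U η A (A' + B') ν μ x = fRem T U η A A' ν μ x + fRem T U η A B' ν μ x := by
  simp only [fRem, curlE₂_add_fun, covDstar_add, curlE₁_add, curlE₂_add, curl_add, R_add, ad_add_right,
    conjRem_add_right]
  abel

/-- … and ℂ-homogeneous in `A′`. [folklore] [cite: Balaban1985BackgroundPropagators, p.405 («The operator F_{1,k}»)] -/
theorem fRem_smul (η : ℝ) (A : ι → S → 𝔸) (c : ℂ) (A' : ι → S → 𝔸) (ν μ : ι) (x : S) :
    fRem T U η A (c • A') ν μ x = c • fRem T U η A A' ν μ x := by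
  simp only [fRem, curlE₂_smul_fun, covDstar_smul, curlE₁_smul, curlE₂_smul, curl_smul, R_smul, conjRem_smul_right]
  rw [← smul_add, R_smul, ad_smul_right, smul_add, smul_sub]

/-- «The operator F_{1,k}»: `A′ ↦ F_{1,k}(A)A′` is additive. [folklore] [cite: Balaban1985BackgroundPropagators, (3.72) p.405] -/
theorem F₁op_add [Fintype ι] (η : ℝ) (A A' B' : ι → S → 𝔸) (μ : ι) (x : S) :
    F₁op T U η A (A' + B') μ x = F₁op T U η A A' μ x + F₁op T U η A B' μ x := by
  simp only [F₁op, fRem_add, Finset.sum_add_distrib, neg_add]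

/-- «The operator F_{1,k}»: `A′ ↦ F_{1,k}(A)A′` is ℂ-homogeneous. [folklore] [cite: Balaban1985BackgroundPropagators, (3.72) p.405] -/
theorem F₁op_smul [Fintype ι] (η : ℝ) (A : ι → S → 𝔸) (c : ℂ) (A' : ι → S → 𝔸) (μ : ι) (x : S) :
    F₁op T U η A (c • A') μ x = c • F₁op T U η A A' μ x := by
  simp only [F₁op, fRem_smul, ← Finset.smul_sum, smul_neg]

/-- «The operator V₁»: `A′ ↦ V₁(A)A′` is additive. [folklore] [cite: Balaban1985BackgroundPropagators, (3.73) p.405] -/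
theorem V₁op_add [Fintype ι] (η : ℝ) (A A' B' : ι → S → 𝔸) (μ : ι) (x : S) :
    V₁op T U η A (A' + B') μ x = V₁op T U η A A' μ x + V₁op T U η A B' μ x := by
  simp only [V₁op, sBracket_add, F₁op_add, Finset.sum_add_distrib]
  abel

/-- «The operator V₁»: `A′ ↦ V₁(A)A′` is ℂ-homogeneous. [folklore] [cite: Balaban1985BackgroundPropagators, (3.73) p.405] -/
theorem V₁op_smul [Fintype ι] (η : ℝ) (A : ι → S → 𝔸) (c : ℂ) (A' : ι → S → 𝔸) (μ : ι) (x : S) :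
    V₁op T U η A (c • A') μ x = c • V₁op T U η A A' μ x := by
  simp only [V₁op, sBracket_smul, F₁op_smul, ← Finset.smul_sum, smul_add]

/-! lapDD -/

omit [NormedAlgebra ℂ 𝔸] [CompleteSpace 𝔸] in
/-- `D*_UD_U` (the operator of (3.71), `B9Eq371Composition.lapDD`: `(D*DA′)_μ(x) = Σ_ν (D*_ν(DA′)_{νμ})(x)`) is additive. [folklore]
[cite: Balaban1985BackgroundPropagators, (3.71) p.405] -/
theorem lapDD_add [Fintype ι] (A' B' : ι → S → 𝔸) (μ : ι) (x : S) :
    lapDD T U (A' + B') μ x = lapDD T U A' μ x + lapDD T U B' μ x := by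
  simp only [lapDD, curl_add_fun, covDstar_add, Finset.sum_add_distrib]

omit [CompleteSpace 𝔸] in
/-- … and ℂ-homogeneous. [folklore] [cite: Balaban1985BackgroundPropagators, (3.71) p.405] -/
theorem lapDD_smul [Fintype ι] (c : ℂ) (A' : ι → S → 𝔸) (μ : ι) (x : S) :
    lapDD T U (c • A') μ x = c • lapDD T U A' μ x := by
  simp only [lapDD, curl_smul_fun, covDstar_smul, ← Finset.smul_sum]

/-- `(V₁(A)A′)_μ(x) = (D*_UD_UA′)_μ(x) − (D*_{U′U}D_{U′U}A′)_μ(x)` — (3.71) solved for `V₁`. [folklore]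
[cite: Balaban1985BackgroundPropagators, (3.71) p.405] -/
theorem V₁op_eq_lapDD_sub [Fintype ι] (η : ℝ) (A A' : ι → S → 𝔸) (μ : ι) (x : S) :
    V₁op T U η A A' μ x = lapDD T U A' μ x - lapDD T (prodCfg U η A) A' μ x := by
  rw [lapDD_prodCfg]; abel

/-! second family -/

omit [CompleteSpace 𝔸] in
/-- The first-order piece `divE₁` of the expansion of `D¹*_{U′U}` in `A` is additive in `A′`. [folklore] -/
theorem divE₁_add (η : ℝ) (A A' B' : ι → S → 𝔸) (ν : ι) (z : S) :
    divE₁ T U η A (A' + B') ν z = divE₁ T U η A A' ν z + divE₁ T U η A B' ν z := by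
  simp only [divE₁, Pi.add_apply, R_add, ad_add_right]

omit [CompleteSpace 𝔸] in
/-- … and ℂ-homogeneous. [folklore] -/
theorem divE₁_smul (η : ℝ) (A : ι → S → 𝔸) (c : ℂ) (A' : ι → S → 𝔸) (ν : ι) (z : S) :
    divE₁ T U η A (c • A') ν z = c • divE₁ T U η A A' ν z := by
  simp only [divE₁, Pi.smul_apply, R_smul, ad_smul_right]

omit [CompleteSpace 𝔸] in
/-- The all-order remainder piece `divE₂` is additive in `A′`. [folklore] -/
theorem divE₂_add (η : ℝ) (A A' B' : ι → S → 𝔸) (ν : ι) (z : S) :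
    divE₂ T U η A (A' + B') ν z = divE₂ T U η A A' ν z + divE₂ T U η A B' ν z := by
  simp only [divE₂, Pi.add_apply, R_add, conjRem_add_right]

omit [CompleteSpace 𝔸] in
/-- … and ℂ-homogeneous. [folklore] -/
theorem divE₂_smul (η : ℝ) (A : ι → S → 𝔸) (c : ℂ) (A' : ι → S → 𝔸) (ν : ι) (z : S) :
    divE₂ T U η A (c • A') ν z = c • divE₂ T U η A A' ν z := by
  simp only [divE₂, Pi.smul_apply, R_smul, conjRem_smul_right]

omit [CompleteSpace 𝔸] in
/-- `divE₂_add` as an identity of site functions. [folklore] -/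
theorem divE₂_add_fun (η : ℝ) (A A' B' : ι → S → 𝔸) (ν : ι) :
    divE₂ T U η A (A' + B') ν = divE₂ T U η A A' ν + divE₂ T U η A B' ν := by
  funext z; simp only [divE₂_add, Pi.add_apply]

omit [CompleteSpace 𝔸] in
/-- `divE₂_smul` as an identity of site functions. [folklore] -/
theorem divE₂_smul_fun (η : ℝ) (A : ι → S → 𝔸) (c : ℂ) (A' : ι → S → 𝔸) (ν : ι) :
    divE₂ T U η A (c • A') ν = c • divE₂ T U η A A' ν := by
  funext z; simp only [divE₂_smul, Pi.smul_apply]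

omit [CompleteSpace 𝔸] in
/-- The seven-term first-order bracket of (3.75) (direction-`ν` summand, `B9Eq375Composition.sBracket₂`) is additive in `A′`. [folklore]
[cite: Balaban1985BackgroundPropagators, (3.75) p.405] -/
theorem sBracket₂_add (η : ℝ) (A A' B' : ι → S → 𝔸) (ν μ : ι) (x : S) :
    sBracket₂ T U η A (A' + B') ν μ x = sBracket₂ T U η A A' ν μ x + sBracket₂ T U η A B' ν μ x := by
  simp only [sBracket₂, Pi.add_apply, covD_add, covDstar_add, R_add, ad_add_right]
  abel

omit [CompleteSpace 𝔸] in
/-- … and ℂ-homogeneous in `A′`. [folklore] [cite: Balaban1985BackgroundPropagators, (3.75) p.405] -/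
theorem sBracket₂_smul (η : ℝ) (A : ι → S → 𝔸) (c : ℂ) (A' : ι → S → 𝔸) (ν μ : ι) (x : S) :
    sBracket₂ T U η A (c • A') ν μ x = c • sBracket₂ T U η A A' ν μ x := by
  simp only [sBracket₂, Pi.smul_apply, covD_smul, covDstar_smul, R_smul, ad_smul_right, smul_add, smul_sub, smul_neg]

/-- The direction-`ν` summand `fRem₂` of `F_{2,k}(A)A′` is additive in `A′`. [folklore]
[cite: Balaban1985BackgroundPropagators, (3.75) p.405 («the operators F_{2,k}(A), V₂(A)»)] -/
theorem fRem₂_add (η : ℝ) (A A' B' : ι → S → 𝔸) (ν μ : ι) (x : S) :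
    fRem₂ T U η A (A' + B') ν μ x = fRem₂ T U η A A' ν μ x + fRem₂ T U η A B' ν μ x := by
  simp only [fRem₂, divE₂_add_fun, covD_add, divE₁_add, divE₂_add, Pi.add_apply, covDstar_add, R_add, ad_add_right,
    conjRem_add_right, add_sub_add_comm]
  abel

/-- … and ℂ-homogeneous in `A′`. [folklore] [cite: Balaban1985BackgroundPropagators, (3.75) p.405 («the operators F_{2,k}(A), V₂(A)»)] -/
theorem fRem₂_smul (η : ℝ) (A : ι → S → 𝔸) (c : ℂ) (A' : ι → S → 𝔸) (ν μ : ι) (x : S) :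
    fRem₂ T U η A (c • A') ν μ x = c • fRem₂ T U η A A' ν μ x := by
  simp only [fRem₂, divE₂_smul_fun, covD_smul, divE₁_smul, divE₂_smul, Pi.smul_apply, covDstar_smul, R_smul,
    ad_smul_right, conjRem_smul_right, smul_add, ← smul_sub]

/-- «the operators F_{2,k}(A), V₂(A)»: `A′ ↦ F_{2,k}(A)A′` is additive. [folklore] [cite: Balaban1985BackgroundPropagators, (3.75) p.405] -/
theorem F₂op_add [Fintype ι] (η : ℝ) (A A' B' : ι → S → 𝔸) (μ : ι) (x : S) :
    F₂op T U η A (A' + B') μ x = F₂op T U η A A' μ x + F₂op T U η A B' μ x := by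
  simp only [F₂op, fRem₂_add, Finset.sum_add_distrib, neg_add]

/-- … and ℂ-homogeneous. [folklore] [cite: Balaban1985BackgroundPropagators, (3.75) p.405] -/
theorem F₂op_smul [Fintype ι] (η : ℝ) (A : ι → S → 𝔸) (c : ℂ) (A' : ι → S → 𝔸) (μ : ι) (x : S) :
    F₂op T U η A (c • A') μ x = c • F₂op T U η A A' μ x := by
  simp only [F₂op, fRem₂_smul, ← Finset.smul_sum, smul_neg]

/-- «the operators F_{2,k}(A), V₂(A)»: `A′ ↦ V₂(A)A′` is additive. [folklore] [cite: Balaban1985BackgroundPropagators, (3.75) p.405] -/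
theorem V₂op_add [Fintype ι] (η : ℝ) (A A' B' : ι → S → 𝔸) (μ : ι) (x : S) :
    V₂op T U η A (A' + B') μ x = V₂op T U η A A' μ x + V₂op T U η A B' μ x := by
  simp only [V₂op, sBracket₂_add, F₂op_add, Finset.sum_add_distrib]
  abel

/-- … and ℂ-homogeneous. [folklore] [cite: Balaban1985BackgroundPropagators, (3.75) p.405] -/
theorem V₂op_smul [Fintype ι] (η : ℝ) (A : ι → S → 𝔸) (c : ℂ) (A' : ι → S → 𝔸) (μ : ι) (x : S) :
    V₂op T U η A (c • A') μ x = c • V₂op T U η A A' μ x := by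
  simp only [V₂op, sBracket₂_smul, F₂op_smul, ← Finset.smul_sum, smul_add]

omit [NormedAlgebra ℂ 𝔸] [CompleteSpace 𝔸] in
/-- `D_UD*_U` (the left-hand operator of (3.75), `B9Eq375Composition.gradDiv`) is additive. [folklore]
[cite: Balaban1985BackgroundPropagators, (3.75) p.405] -/
theorem gradDiv_add [Fintype ι] (A' B' : ι → S → 𝔸) (μ : ι) (x : S) :
    gradDiv T U (A' + B') μ x = gradDiv T U A' μ x + gradDiv T U B' μ x := by
  simp only [gradDiv, Pi.add_apply, ← Finset.sum_add_distrib, ← covD_add]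
  congr 1; funext ν; congr 1; funext z; exact covDstar_add T U ν (A' ν) (B' ν) z

omit [CompleteSpace 𝔸] in
/-- … and ℂ-homogeneous. [folklore] [cite: Balaban1985BackgroundPropagators, (3.75) p.405] -/
theorem gradDiv_smul [Fintype ι] (c : ℂ) (A' : ι → S → 𝔸) (μ : ι) (x : S) :
    gradDiv T U (c • A') μ x = c • gradDiv T U A' μ x := by
  simp only [gradDiv, Pi.smul_apply, Finset.smul_sum, ← covD_smul]
  congr 1; funext ν; congr 1; funext z; exact covDstar_smul T U c ν (A' ν) z

/-- `(V₂(A)A′)_μ(x) = (D_UD*_UA′)_μ(x) − (D_{U′U}D*_{U′U}A′)_μ(x)` — (3.75) solved for `V₂`. [folklore]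
[cite: Balaban1985BackgroundPropagators, (3.75) p.405] -/
theorem V₂op_eq_gradDiv_sub [Fintype ι] (η : ℝ) (A A' : ι → S → 𝔸) (μ : ι) (x : S) :
    V₂op T U η A A' μ x = gradDiv T U A' μ x - gradDiv T (prodCfg U η A) A' μ x := by
  rw [gradDiv_prodCfg]; abel

end Letters

section LinearMaps

variable {𝔸 : Type*} [NormedRing 𝔸] [NormedAlgebra ℂ 𝔸] [CompleteSpace 𝔸] {S : Type*} {ι : Type*} [Fintype ι]
variable (T : ι → Equiv.Perm S) (U : ι → S → 𝔸ˣ)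

/-- `D*_UD_U` of (3.71) as a ℂ-linear operator on vector fields `ι → S → 𝔸`. [folklore] [cite: Balaban1985BackgroundPropagators, (3.71) p.405] -/
def lapDDlin : (ι → S → 𝔸) →ₗ[ℂ] (ι → S → 𝔸) where
  toFun A' := lapDD T U A'
  map_add' A' B' := by funext μ x; exact lapDD_add T U A' B' μ x
  map_smul' c A' := by funext μ x; exact lapDD_smul T U c A' μ x

/-- `D_UD*_U` of (3.75) as a ℂ-linear operator. [folklore] [cite: Balaban1985BackgroundPropagators, (3.75) p.405] -/
def gradDivlin : (ι → S → 𝔸) →ₗ[ℂ] (ι → S → 𝔸) where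
  toFun A' := gradDiv T U A'
  map_add' A' B' := by funext μ x; exact gradDiv_add T U A' B' μ x
  map_smul' c A' := by funext μ x; exact gradDiv_smul T U c A' μ x

/-- «The operator F_{1,k}» as an element of `End_ℂ(ι → S → 𝔸)` (exponent field `A` fixed). [folklore]
[cite: Balaban1985BackgroundPropagators, (3.72) p.405] -/
def F₁lin (η : ℝ) (A : ι → S → 𝔸) : (ι → S → 𝔸) →ₗ[ℂ] (ι → S → 𝔸) where
  toFun A' := F₁op T U η A A'
  map_add' A' B' := by funext μ x; exact F₁op_add T U η A A' B' μ x
  map_smul' c A' := by funext μ x; exact F₁op_smul T U η A c A' μ x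

/-- «The operator V₁» as an element of `End_ℂ(ι → S → 𝔸)`. [folklore] [cite: Balaban1985BackgroundPropagators, (3.73) p.405] -/
def V₁lin (η : ℝ) (A : ι → S → 𝔸) : (ι → S → 𝔸) →ₗ[ℂ] (ι → S → 𝔸) where
  toFun A' := V₁op T U η A A'
  map_add' A' B' := by funext μ x; exact V₁op_add T U η A A' B' μ x
  map_smul' c A' := by funext μ x; exact V₁op_smul T U η A c A' μ x

/-- «the operators F_{2,k}(A), …» as an element of `End_ℂ(ι → S → 𝔸)`. [folklore] [cite: Balaban1985BackgroundPropagators, (3.75) p.405] -/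
def F₂lin (η : ℝ) (A : ι → S → 𝔸) : (ι → S → 𝔸) →ₗ[ℂ] (ι → S → 𝔸) where
  toFun A' := F₂op T U η A A'
  map_add' A' B' := by funext μ x; exact F₂op_add T U η A A' B' μ x
  map_smul' c A' := by funext μ x; exact F₂op_smul T U η A c A' μ x

/-- «…, V₂(A)» as an element of `End_ℂ(ι → S → 𝔸)`. [folklore] [cite: Balaban1985BackgroundPropagators, (3.75) p.405] -/
def V₂lin (η : ℝ) (A : ι → S → 𝔸) : (ι → S → 𝔸) →ₗ[ℂ] (ι → S → 𝔸) where
  toFun A' := V₂op T U η A A'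
  map_add' A' B' := by funext μ x; exact V₂op_add T U η A A' B' μ x
  map_smul' c A' := by funext μ x; exact V₂op_smul T U η A c A' μ x

omit [CompleteSpace 𝔸] in
/-- [folklore] -/
@[simp] theorem lapDDlin_apply (A' : ι → S → 𝔸) : lapDDlin T U A' = lapDD T U A' := rfl
omit [CompleteSpace 𝔸] in
/-- [folklore] -/
@[simp] theorem gradDivlin_apply (A' : ι → S → 𝔸) : gradDivlin T U A' = gradDiv T U A' := rfl
/-- [folklore] -/
@[simp] theorem F₁lin_apply (η : ℝ) (A A' : ι → S → 𝔸) : F₁lin T U η A A' = F₁op T U η A A' := rfl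
/-- [folklore] -/
@[simp] theorem V₁lin_apply (η : ℝ) (A A' : ι → S → 𝔸) : V₁lin T U η A A' = V₁op T U η A A' := rfl
/-- [folklore] -/
@[simp] theorem F₂lin_apply (η : ℝ) (A A' : ι → S → 𝔸) : F₂lin T U η A A' = F₂op T U η A A' := rfl
/-- [folklore] -/
@[simp] theorem V₂lin_apply (η : ℝ) (A A' : ι → S → 𝔸) : V₂lin T U η A A' = V₂op T U η A A' := rfl

/-- (3.71) as an identity in `End_ℂ`: `D*_{U′U}D_{U′U} = D*_UD_U − V₁(A)`. [folklore]
[cite: Balaban1985BackgroundPropagators, (3.71) p.405] -/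
theorem lapDDlin_prodCfg (η : ℝ) (A : ι → S → 𝔸) :
    lapDDlin T (prodCfg U η A) = lapDDlin T U - V₁lin T U η A := by
  ext A' μ x
  simp only [lapDDlin_apply, LinearMap.sub_apply, V₁lin_apply, Pi.sub_apply]
  rw [lapDD_prodCfg]

/-- (3.75) as an identity in `End_ℂ`: `D_{U′U}D*_{U′U} = D_UD*_U − V₂(A)`. [folklore] [cite: Balaban1985BackgroundPropagators, (3.75) p.405] -/
theorem gradDivlin_prodCfg (η : ℝ) (A : ι → S → 𝔸) :
    gradDivlin T (prodCfg U η A) = gradDivlin T U - V₂lin T U η A := by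
  ext A' μ x
  simp only [gradDivlin_apply, LinearMap.sub_apply, V₂lin_apply, Pi.sub_apply]
  rw [gradDiv_prodCfg]

/-- `V₁(A) = D*_UD_U − D*_{U′U}D_{U′U}` in `End_ℂ` — the perturbation IS the difference of the operators of (3.71). [folklore]
[cite: Balaban1985BackgroundPropagators, (3.71) p.405] -/
theorem V₁lin_eq_sub (η : ℝ) (A : ι → S → 𝔸) : V₁lin T U η A = lapDDlin T U - lapDDlin T (prodCfg U η A) := by
  rw [lapDDlin_prodCfg, sub_sub_cancel]

/-- `V₂(A) = D_UD*_U − D_{U′U}D*_{U′U}` in `End_ℂ` ((3.75)). [folklore] [cite: Balaban1985BackgroundPropagators, (3.75) p.405] -/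
theorem V₂lin_eq_sub (η : ℝ) (A : ι → S → 𝔸) : V₂lin T U η A = gradDivlin T U - gradDivlin T (prodCfg U η A) := by
  rw [gradDivlin_prodCfg, sub_sub_cancel]

end LinearMaps

section Continuity

variable {𝔸 : Type*} [NormedRing 𝔸] [NormedAlgebra ℂ 𝔸] [CompleteSpace 𝔸] {S : Type*} {ι : Type*} [Fintype ι]
variable (T : ι → Equiv.Perm S) (U : ι → S → 𝔸ˣ)

omit [CompleteSpace 𝔸] [Fintype ι] in
/-- `A′ ↦` the direction-`ν` bracket of (3.75) at `(μ, x)` is continuous (product topology). [folklore] -/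
@[fun_prop] theorem continuous_sBracket₂ (η : ℝ) (A : ι → S → 𝔸) (ν μ : ι) (x : S) :
    Continuous fun A' : ι → S → 𝔸 => sBracket₂ T U η A A' ν μ x := by
  unfold sBracket₂ B9Eq39Adjoint.covD covDstar R ad
  fun_prop

omit [CompleteSpace 𝔸] [Fintype ι] in
/-- [folklore] -/
@[fun_prop] theorem continuous_divE₁ (η : ℝ) (A : ι → S → 𝔸) (ν : ι) (z : S) :
    Continuous fun A' : ι → S → 𝔸 => divE₁ T U η A A' ν z := by
  unfold divE₁ R ad
  fun_prop

omit [CompleteSpace 𝔸] [Fintype ι] in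
/-- [folklore] -/
@[fun_prop] theorem continuous_divE₂ (η : ℝ) (A : ι → S → 𝔸) (ν : ι) (z : S) :
    Continuous fun A' : ι → S → 𝔸 => divE₂ T U η A A' ν z := by
  unfold divE₂ conjRem R ad
  fun_prop

omit [Fintype ι] in
/-- `A′ ↦ fRem₂ … A′ ν μ x` is continuous. [folklore] -/
@[fun_prop] theorem continuous_fRem₂ (η : ℝ) (A : ι → S → 𝔸) (ν μ : ι) (x : S) :
    Continuous fun A' : ι → S → 𝔸 => fRem₂ T U η A A' ν μ x := by
  unfold fRem₂
  simp only [B9Eq39Adjoint.covD, covDstar, conjRem, R, ad]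
  fun_prop

/-- `A′ ↦ (F_{2,k}(A)A′)_μ(x)` is continuous. [folklore] -/
@[fun_prop] theorem continuous_F₂op_apply (η : ℝ) (A : ι → S → 𝔸) (μ : ι) (x : S) :
    Continuous fun A' : ι → S → 𝔸 => F₂op T U η A A' μ x := by
  unfold F₂op
  fun_prop

/-- `A′ ↦ (V₂(A)A′)_μ(x)` is continuous. [folklore] -/
@[fun_prop] theorem continuous_V₂op_apply (η : ℝ) (A : ι → S → 𝔸) (μ : ι) (x : S) :
    Continuous fun A' : ι → S → 𝔸 => V₂op T U η A A' μ x := by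
  unfold V₂op
  fun_prop

/-- `A′ ↦ V₂(A)A′` is continuous. [folklore] -/
theorem continuous_V₂op (η : ℝ) (A : ι → S → 𝔸) : Continuous fun A' : ι → S → 𝔸 => V₂op T U η A A' := by
  apply continuous_pi; intro μ; apply continuous_pi; intro x
  fun_prop

/-- `A′ ↦ F_{2,k}(A)A′` is continuous. [folklore] -/
theorem continuous_F₂op (η : ℝ) (A : ι → S → 𝔸) : Continuous fun A' : ι → S → 𝔸 => F₂op T U η A A' := by
  apply continuous_pi; intro μ; apply continuous_pi; intro x
  fun_prop

omit [CompleteSpace 𝔸] [Fintype ι] in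
/-- `A′ ↦` the direction-`ν` bracket of (3.71) at `(μ, x)` is continuous. [folklore] -/
@[fun_prop] theorem continuous_sBracket (η : ℝ) (A : ι → S → 𝔸) (ν μ : ι) (x : S) :
    Continuous fun A' : ι → S → 𝔸 => sBracket T U η A A' ν μ x := by
  unfold sBracket curl B9Eq39Adjoint.covD covDstar R ad
  fun_prop

omit [CompleteSpace 𝔸] [Fintype ι] in
/-- [folklore] -/
@[fun_prop] theorem continuous_curlE₁ (η : ℝ) (A : ι → S → 𝔸) (ν μ : ι) (z : S) :
    Continuous fun A' : ι → S → 𝔸 => curlE₁ T U η A A' ν μ z := by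
  unfold curlE₁ R ad
  fun_prop

omit [CompleteSpace 𝔸] [Fintype ι] in
/-- [folklore] -/
@[fun_prop] theorem continuous_curlE₂ (η : ℝ) (A : ι → S → 𝔸) (ν μ : ι) (z : S) :
    Continuous fun A' : ι → S → 𝔸 => curlE₂ T U η A A' ν μ z := by
  unfold curlE₂ conjRem R ad
  fun_prop

omit [Fintype ι] in
/-- `A′ ↦ fRem … A′ ν μ x` is continuous. [folklore] -/
@[fun_prop] theorem continuous_fRem (η : ℝ) (A : ι → S → 𝔸) (ν μ : ι) (x : S) :
    Continuous fun A' : ι → S → 𝔸 => fRem T U η A A' ν μ x := by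
  unfold fRem
  simp only [curl, B9Eq39Adjoint.covD, covDstar, conjRem, R, ad]
  fun_prop

/-- `A′ ↦ (F_{1,k}(A)A′)_μ(x)` is continuous. [folklore] -/
@[fun_prop] theorem continuous_F₁op_apply (η : ℝ) (A : ι → S → 𝔸) (μ : ι) (x : S) :
    Continuous fun A' : ι → S → 𝔸 => F₁op T U η A A' μ x := by
  unfold F₁op
  fun_prop

/-- `A′ ↦ (V₁(A)A′)_μ(x)` is continuous. [folklore] -/
@[fun_prop] theorem continuous_V₁op_apply (η : ℝ) (A : ι → S → 𝔸) (μ : ι) (x : S) :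
    Continuous fun A' : ι → S → 𝔸 => V₁op T U η A A' μ x := by
  unfold V₁op
  fun_prop

/-- `A′ ↦ V₁(A)A′` is continuous. [folklore] -/
theorem continuous_V₁op (η : ℝ) (A : ι → S → 𝔸) : Continuous fun A' : ι → S → 𝔸 => V₁op T U η A A' := by
  apply continuous_pi; intro μ; apply continuous_pi; intro x
  fun_prop

/-- `A′ ↦ F_{1,k}(A)A′` is continuous. [folklore] -/
theorem continuous_F₁op (η : ℝ) (A : ι → S → 𝔸) : Continuous fun A' : ι → S → 𝔸 => F₁op T U η A A' := by
  apply continuous_pi; intro μ; apply continuous_pi; intro x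
  fun_prop

/-- «It is a local, bounded operator»: `F_{1,k}(A)` as a continuous linear operator on vector fields (product topology; on a finite
lattice the sup-normed space of (3.39)). [folklore] [cite: Balaban1985BackgroundPropagators, (3.72) p.405] -/
def F₁L (η : ℝ) (A : ι → S → 𝔸) : (ι → S → 𝔸) →L[ℂ] (ι → S → 𝔸) := ⟨F₁lin T U η A, continuous_F₁op T U η A⟩
/-- «The operator V₁» as a continuous linear operator. [folklore] [cite: Balaban1985BackgroundPropagators, (3.73) p.405] -/
def V₁L (η : ℝ) (A : ι → S → 𝔸) : (ι → S → 𝔸) →L[ℂ] (ι → S → 𝔸) := ⟨V₁lin T U η A, continuous_V₁op T U η A⟩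
/-- `F_{2,k}(A)` as a continuous linear operator. [folklore] [cite: Balaban1985BackgroundPropagators, (3.75) p.405] -/
def F₂L (η : ℝ) (A : ι → S → 𝔸) : (ι → S → 𝔸) →L[ℂ] (ι → S → 𝔸) := ⟨F₂lin T U η A, continuous_F₂op T U η A⟩
/-- `V₂(A)` as a continuous linear operator. [folklore] [cite: Balaban1985BackgroundPropagators, (3.75) p.405] -/
def V₂L (η : ℝ) (A : ι → S → 𝔸) : (ι → S → 𝔸) →L[ℂ] (ι → S → 𝔸) := ⟨V₂lin T U η A, continuous_V₂op T U η A⟩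

/-- [folklore] -/
@[simp] theorem F₁L_apply (η : ℝ) (A A' : ι → S → 𝔸) : F₁L T U η A A' = F₁op T U η A A' := rfl
/-- [folklore] -/
@[simp] theorem V₁L_apply (η : ℝ) (A A' : ι → S → 𝔸) : V₁L T U η A A' = V₁op T U η A A' := rfl
/-- [folklore] -/
@[simp] theorem F₂L_apply (η : ℝ) (A A' : ι → S → 𝔸) : F₂L T U η A A' = F₂op T U η A A' := rfl
/-- [folklore] -/
@[simp] theorem V₂L_apply (η : ℝ) (A A' : ι → S → 𝔸) : V₂L T U η A A' = V₂op T U η A A' := rfl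

omit [NormedAlgebra ℂ 𝔸] [CompleteSpace 𝔸] in
/-- `A′ ↦ (D*_UD_UA′)_μ(x)` is continuous (product topology). [folklore] -/
@[fun_prop] theorem continuous_lapDD_apply (μ : ι) (x : S) : Continuous fun A' : ι → S → 𝔸 => lapDD T U A' μ x := by
  unfold lapDD curl B9Eq39Adjoint.covD covDstar R
  fun_prop

omit [NormedAlgebra ℂ 𝔸] [CompleteSpace 𝔸] in
/-- `A′ ↦ (D_UD*_UA′)_μ(x)` is continuous. [folklore] -/
@[fun_prop] theorem continuous_gradDiv_apply (μ : ι) (x : S) : Continuous fun A' : ι → S → 𝔸 => gradDiv T U A' μ x := by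
  unfold gradDiv B9Eq39Adjoint.covD covDstar R
  fun_prop

omit [NormedAlgebra ℂ 𝔸] [CompleteSpace 𝔸] in
/-- `A′ ↦ D*_UD_UA′` is continuous. [folklore] -/
theorem continuous_lapDD : Continuous fun A' : ι → S → 𝔸 => lapDD T U A' := by
  apply continuous_pi; intro μ; apply continuous_pi; intro x
  fun_prop

omit [NormedAlgebra ℂ 𝔸] [CompleteSpace 𝔸] in
/-- `A′ ↦ D_UD*_UA′` is continuous. [folklore] -/
theorem continuous_gradDiv : Continuous fun A' : ι → S → 𝔸 => gradDiv T U A' := by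
  apply continuous_pi; intro μ; apply continuous_pi; intro x
  fun_prop

/-- `D*_UD_U` of (3.71) as a continuous linear operator on vector fields. [folklore] [cite: Balaban1985BackgroundPropagators, (3.71) p.405] -/
def lapDDL : (ι → S → 𝔸) →L[ℂ] (ι → S → 𝔸) := ⟨lapDDlin T U, continuous_lapDD T U⟩

/-- `D_UD*_U` of (3.75) as a continuous linear operator. [folklore] [cite: Balaban1985BackgroundPropagators, (3.75) p.405] -/
def gradDivL : (ι → S → 𝔸) →L[ℂ] (ι → S → 𝔸) := ⟨gradDivlin T U, continuous_gradDiv T U⟩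

omit [CompleteSpace 𝔸] in
/-- [folklore] -/
@[simp] theorem lapDDL_apply (A' : ι → S → 𝔸) : lapDDL T U A' = lapDD T U A' := rfl

omit [CompleteSpace 𝔸] in
/-- [folklore] -/
@[simp] theorem gradDivL_apply (A' : ι → S → 𝔸) : gradDivL T U A' = gradDiv T U A' := rfl

/-- (3.71) as an identity of CONTINUOUS linear operators: `D*_{U′U}D_{U′U} = D*_UD_U − V₁(A)`. [folklore]
[cite: Balaban1985BackgroundPropagators, (3.71) p.405] -/
theorem lapDDL_prodCfg (η : ℝ) (A : ι → S → 𝔸) : lapDDL T (prodCfg U η A) = lapDDL T U - V₁L T U η A := by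
  ext A' μ x
  simp only [lapDDL_apply, FunLike.coe_sub, Pi.sub_apply, V₁L_apply, Pi.sub_apply]
  rw [lapDD_prodCfg]

/-- (3.75) as an identity of CONTINUOUS linear operators: `D_{U′U}D*_{U′U} = D_UD*_U − V₂(A)`. [folklore]
[cite: Balaban1985BackgroundPropagators, (3.75) p.405] -/
theorem gradDivL_prodCfg (η : ℝ) (A : ι → S → 𝔸) : gradDivL T (prodCfg U η A) = gradDivL T U - V₂L T U η A := by
  ext A' μ x
  simp only [gradDivL_apply, FunLike.coe_sub, Pi.sub_apply, V₂L_apply, Pi.sub_apply]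
  rw [gradDiv_prodCfg]

/-- `V₂(0) = 0`: no fluctuation field, no perturbation (`prodCfg U η 0 = U`, `B9Eq369Product.prodCfg_zero`). [folklore] -/
theorem V₂L_zero (η : ℝ) : V₂L T U η (0 : ι → S → 𝔸) = 0 := by
  ext A' μ x
  rw [V₂L_apply, V₂op_eq_gradDiv_sub, prodCfg_zero, sub_self]
  rfl

/-- `V₁(0) = 0`. [folklore] -/
theorem V₁L_zero (η : ℝ) : V₁L T U η (0 : ι → S → 𝔸) = 0 := by
  ext A' μ x
  rw [V₁L_apply, V₁op_eq_lapDD_sub, prodCfg_zero, sub_self]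
  rfl

end Continuity

section OperatorNorm

variable {𝔸 : Type*} [NormedRing 𝔸] [NormedAlgebra ℂ 𝔸] [CompleteSpace 𝔸] {S : Type*} {ι : Type*} [Fintype ι] [Fintype S]
variable (T : ι → Equiv.Perm S) (U : ι → S → 𝔸ˣ)

omit [NormedAlgebra ℂ 𝔸] [CompleteSpace 𝔸] in
/-- (3.39): `|A′_κ(z)| ≤ |A′| = max_κ sup_z |A′_κ(z)|` — the Pi sup norm on a finite lattice. [folklore]
[cite: Balaban1985BackgroundPropagators, (3.39) p.397] -/
theorem norm_apply_le_pi (A' : ι → S → 𝔸) (κ : ι) (z : S) : ‖A' κ z‖ ≤ ‖A'‖ :=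
  (norm_le_pi_norm (A' κ) z).trans (norm_le_pi_norm A' κ)

omit [NormedAlgebra ℂ 𝔸] [CompleteSpace 𝔸] in
/-- The `η`-normalised gradient seminorm of (3.39) is dominated by the sup norm: `‖(D¹_κA′_τ)(z)‖ ≤ (ρ² + 1)‖A′‖` for transports of size
`‖U(b)‖, ‖U(b)⁻¹‖ ≤ ρ`. [folklore] [cite: Balaban1985BackgroundPropagators, (3.39) p.397] -/
theorem norm_covD_le_pi {ρ : ℝ} (hU : ∀ κ z, ‖(U κ z : 𝔸)‖ ≤ ρ) (hU' : ∀ κ z, ‖(((U κ z)⁻¹ : 𝔸ˣ) : 𝔸)‖ ≤ ρ)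
    (A' : ι → S → 𝔸) (κ τ : ι) (z : S) : ‖covD T U κ (A' τ) z‖ ≤ (ρ ^ 2 + 1) * ‖A'‖ := by
  unfold B9Eq39Adjoint.covD
  calc _ ≤ ‖R (U κ z) (A' τ (T κ z))‖ + ‖A' τ z‖ := norm_sub_le _ _
    _ ≤ ρ ^ 2 * ‖A'‖ + ‖A'‖ := add_le_add ((norm_R_le_sq (U κ z) (hU κ z) (hU' κ z) _).trans
        (mul_le_mul_of_nonneg_left (norm_apply_le_pi A' τ _) (sq_nonneg _))) (norm_apply_le_pi A' τ z)
    _ = _ := by ring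

omit [NormedAlgebra ℂ 𝔸] [CompleteSpace 𝔸] in
/-- A uniform pointwise bound on a vector field bounds its sup norm. [folklore] -/
theorem pi_norm_le_of_forall₂ {C : ℝ} (hC : 0 ≤ C) (G : ι → S → 𝔸) (h : ∀ μ x, ‖G μ x‖ ≤ C) : ‖G‖ ≤ C := by
  rw [pi_norm_le_iff_of_nonneg hC]
  intro μ
  rw [pi_norm_le_iff_of_nonneg hC]
  exact h μ

/-! constants -/

/-- The constant of (3.72) in operator-norm form: `CF c d η ρ a = d·c·ρ⁴s²e^{2s}(3 + 2s + s²e^{2s})`, `s = ηρ²a` (`c = 8` for `F₁`, `c = 4` for `F₂`;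
the printed `O(1)|A|²`, ×`η²`). [folklore] [cite: Balaban1985BackgroundPropagators, (3.72) p.405] -/
def CF (c : ℝ) (d : ℕ) (η ρ a : ℝ) : ℝ :=
  d * (c * ρ ^ 4 * (η * ρ ^ 2 * a) ^ 2 * Real.exp (2 * (η * ρ ^ 2 * a))
    * (3 + 2 * (η * ρ ^ 2 * a) + (η * ρ ^ 2 * a) ^ 2 * Real.exp (2 * (η * ρ ^ 2 * a))))

/-- The constant of (3.73) for `V₁` in operator-norm form (`|∇A′|` absorbed by `(ρ² + 1)|A′|`):
`d·η((8ρ² + 4)a(ρ² + 1) + 2ρ²(1 + ρ²)g) + CF 8 d η ρ a`. [folklore] [cite: Balaban1985BackgroundPropagators, (3.73) p.405] -/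
def CV₁ (d : ℕ) (η ρ a g : ℝ) : ℝ :=
  d * (η * ((8 * ρ ^ 2 + 4) * a * (ρ ^ 2 + 1) + 2 * ρ ^ 2 * (1 + ρ ^ 2) * g))
    + CF 8 d η ρ a

/-- The constant of (3.73) for `V₂` in operator-norm form: `d·η((4ρ⁴ + 2ρ² + 2)a(ρ² + 1) + 2ρ²(1 + ρ² + ρ⁴)g) + CF 4 d η ρ a`. [folklore]
[cite: Balaban1985BackgroundPropagators, (3.73), (3.75) p.405] -/
def CV₂ (d : ℕ) (η ρ a g : ℝ) : ℝ :=
  d * (η * ((4 * ρ ^ 4 + 2 * ρ ^ 2 + 2) * a * (ρ ^ 2 + 1) + 2 * ρ ^ 2 * (1 + ρ ^ 2 + ρ ^ 4) * g))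
    + CF 4 d η ρ a

/-- [folklore] -/
theorem CF_nonneg {c : ℝ} (hc : 0 ≤ c) (d : ℕ) {η ρ a : ℝ} (hη : 0 ≤ η) (hρ : 1 ≤ ρ) (ha : 0 ≤ a) :
    0 ≤ CF c d η ρ a := by
  unfold CF
  have hρ0 : 0 ≤ ρ := zero_le_one.trans hρ
  positivity

/-- [folklore] -/
theorem CV₁_nonneg (d : ℕ) {η ρ a g : ℝ} (hη : 0 ≤ η) (hρ : 1 ≤ ρ) (ha : 0 ≤ a) (hg : 0 ≤ g) : 0 ≤ CV₁ d η ρ a g := by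
  unfold CV₁
  have hρ0 : 0 ≤ ρ := zero_le_one.trans hρ
  have := CF_nonneg (by norm_num : (0:ℝ) ≤ 8) d hη hρ ha
  positivity

/-- [folklore] -/
theorem CV₂_nonneg (d : ℕ) {η ρ a g : ℝ} (hη : 0 ≤ η) (hρ : 1 ≤ ρ) (ha : 0 ≤ a) (hg : 0 ≤ g) : 0 ≤ CV₂ d η ρ a g := by
  unfold CV₂
  have hρ0 : 0 ≤ ρ := zero_le_one.trans hρ
  have := CF_nonneg (by norm_num : (0:ℝ) ≤ 4) d hη hρ ha
  positivity

/-! F₂ -/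

/-- (3.72), first inequality, for `F_{2,k}` in sup norm: `‖F₂(A)A′‖ ≤ CF 4 d η ρ a·‖A′‖`. [folklore]
[cite: Balaban1985BackgroundPropagators, (3.72), (3.75) p.405] -/
theorem norm_F₂L_apply_le {η ρ a : ℝ} (hη : 0 ≤ η) (hρ : 1 ≤ ρ) (ha : 0 ≤ a)
    (hU : ∀ κ z, ‖(U κ z : 𝔸)‖ ≤ ρ) (hU' : ∀ κ z, ‖(((U κ z)⁻¹ : 𝔸ˣ) : 𝔸)‖ ≤ ρ)
    (A : ι → S → 𝔸) (hA : ∀ κ z, ‖A κ z‖ ≤ a) (A' : ι → S → 𝔸) :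
    ‖F₂L T U η A A'‖ ≤ CF 4 (Fintype.card ι) η ρ a * ‖A'‖ := by
  have hC := CF_nonneg (by norm_num : (0:ℝ) ≤ 4) (Fintype.card ι) hη hρ ha
  refine pi_norm_le_of_forall₂ (by positivity) _ fun μ x => ?_
  have h := norm_F₂op_le T U hη hρ hU hU' A A' hA (fun κ z => norm_apply_le_pi A' κ z) μ x
  refine h.trans (le_of_eq ?_)
  unfold CF
  ring

/-- «bounded operator»: `‖F₂(A)‖_{op} ≤ d·4ρ⁴s²e^{2s}(3 + 2s + s²e^{2s})`, `s = ηρ²|A|`. [folklore]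
[cite: Balaban1985BackgroundPropagators, (3.72), (3.75) p.405] -/
theorem opNorm_F₂L_le {η ρ a : ℝ} (hη : 0 ≤ η) (hρ : 1 ≤ ρ) (ha : 0 ≤ a)
    (hU : ∀ κ z, ‖(U κ z : 𝔸)‖ ≤ ρ) (hU' : ∀ κ z, ‖(((U κ z)⁻¹ : 𝔸ˣ) : 𝔸)‖ ≤ ρ)
    (A : ι → S → 𝔸) (hA : ∀ κ z, ‖A κ z‖ ≤ a) :
    ‖F₂L T U η A‖ ≤ CF 4 (Fintype.card ι) η ρ a :=
  ContinuousLinearMap.opNorm_le_bound _ (CF_nonneg (by norm_num : (0:ℝ) ≤ 4) (Fintype.card ι) hη hρ ha)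
    (norm_F₂L_apply_le T U hη hρ ha hU hU' A hA)

/-! V₂ -/

/-- (3.73), first inequality, for `V₂` in sup norm: `‖V₂(A)A′‖ ≤ CV₂ d η ρ a g·‖A′‖`. [folklore]
[cite: Balaban1985BackgroundPropagators, (3.73), (3.75) p.405] -/
theorem norm_V₂L_apply_le {η ρ a g : ℝ} (hη : 0 ≤ η) (hρ : 1 ≤ ρ) (ha : 0 ≤ a) (hg : 0 ≤ g)
    (hU : ∀ κ z, ‖(U κ z : 𝔸)‖ ≤ ρ) (hU' : ∀ κ z, ‖(((U κ z)⁻¹ : 𝔸ˣ) : 𝔸)‖ ≤ ρ)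
    (A : ι → S → 𝔸) (hA : ∀ κ z, ‖A κ z‖ ≤ a) (hdA : ∀ κ τ z, ‖covD T U κ (A τ) z‖ ≤ g) (A' : ι → S → 𝔸) :
    ‖V₂L T U η A A'‖ ≤ CV₂ (Fintype.card ι) η ρ a g * ‖A'‖ := by
  have hC := CV₂_nonneg (Fintype.card ι) hη hρ ha hg
  refine pi_norm_le_of_forall₂ (by positivity) _ fun μ x => ?_
  have h := norm_V₂op_le T U hη hρ hU hU' A A' hA (fun κ z => norm_apply_le_pi A' κ z) hdA
    (fun κ τ z => norm_covD_le_pi T U hU hU' A' κ τ z) μ x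
  refine h.trans (le_of_eq ?_)
  unfold CV₂ CF
  ring

/-- «bounded operator»: `‖V₂(A)‖_{op} ≤ CV₂ d η ρ |A| |D¹A|`. [folklore] [cite: Balaban1985BackgroundPropagators, (3.73), (3.75) p.405] -/
theorem opNorm_V₂L_le {η ρ a g : ℝ} (hη : 0 ≤ η) (hρ : 1 ≤ ρ) (ha : 0 ≤ a) (hg : 0 ≤ g)
    (hU : ∀ κ z, ‖(U κ z : 𝔸)‖ ≤ ρ) (hU' : ∀ κ z, ‖(((U κ z)⁻¹ : 𝔸ˣ) : 𝔸)‖ ≤ ρ)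
    (A : ι → S → 𝔸) (hA : ∀ κ z, ‖A κ z‖ ≤ a) (hdA : ∀ κ τ z, ‖covD T U κ (A τ) z‖ ≤ g) :
    ‖V₂L T U η A‖ ≤ CV₂ (Fintype.card ι) η ρ a g :=
  ContinuousLinearMap.opNorm_le_bound _ (CV₂_nonneg (Fintype.card ι) hη hρ ha hg)
    (norm_V₂L_apply_le T U hη hρ ha hg hU hU' A hA hdA)

/-! F₁ -/

/-- (3.72), first inequality, for `F_{1,k}` in sup norm: `‖F₁(A)A′‖ ≤ CF 8 d η ρ a·‖A′‖`. [folklore]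
[cite: Balaban1985BackgroundPropagators, (3.72) p.405] -/
theorem norm_F₁L_apply_le {η ρ a : ℝ} (hη : 0 ≤ η) (hρ : 1 ≤ ρ) (ha : 0 ≤ a)
    (hU : ∀ κ z, ‖(U κ z : 𝔸)‖ ≤ ρ) (hU' : ∀ κ z, ‖(((U κ z)⁻¹ : 𝔸ˣ) : 𝔸)‖ ≤ ρ)
    (A : ι → S → 𝔸) (hA : ∀ κ z, ‖A κ z‖ ≤ a) (A' : ι → S → 𝔸) :
    ‖F₁L T U η A A'‖ ≤ CF 8 (Fintype.card ι) η ρ a * ‖A'‖ := by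
  have hC := CF_nonneg (by norm_num : (0:ℝ) ≤ 8) (Fintype.card ι) hη hρ ha
  refine pi_norm_le_of_forall₂ (by positivity) _ fun μ x => ?_
  have h := norm_F₁op_le T U hη hρ hU hU' A A' hA (fun κ z => norm_apply_le_pi A' κ z) μ x
  refine h.trans (le_of_eq ?_)
  unfold CF
  ring

/-- «It is a local, bounded operator satisfying the bound (3.72)»: `‖F₁(A)‖_{op} ≤ d·8ρ⁴s²e^{2s}(3 + 2s + s²e^{2s})`. [folklore]
[cite: Balaban1985BackgroundPropagators, (3.72) p.405] -/
theorem opNorm_F₁L_le {η ρ a : ℝ} (hη : 0 ≤ η) (hρ : 1 ≤ ρ) (ha : 0 ≤ a)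
    (hU : ∀ κ z, ‖(U κ z : 𝔸)‖ ≤ ρ) (hU' : ∀ κ z, ‖(((U κ z)⁻¹ : 𝔸ˣ) : 𝔸)‖ ≤ ρ)
    (A : ι → S → 𝔸) (hA : ∀ κ z, ‖A κ z‖ ≤ a) :
    ‖F₁L T U η A‖ ≤ CF 8 (Fintype.card ι) η ρ a :=
  ContinuousLinearMap.opNorm_le_bound _ (CF_nonneg (by norm_num : (0:ℝ) ≤ 8) (Fintype.card ι) hη hρ ha)
    (norm_F₁L_apply_le T U hη hρ ha hU hU' A hA)

/-! V₁ -/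

/-- (3.73), first inequality, for `V₁` in sup norm: `‖V₁(A)A′‖ ≤ CV₁ d η ρ a g·‖A′‖`. [folklore]
[cite: Balaban1985BackgroundPropagators, (3.73) p.405] -/
theorem norm_V₁L_apply_le {η ρ a g : ℝ} (hη : 0 ≤ η) (hρ : 1 ≤ ρ) (ha : 0 ≤ a) (hg : 0 ≤ g)
    (hU : ∀ κ z, ‖(U κ z : 𝔸)‖ ≤ ρ) (hU' : ∀ κ z, ‖(((U κ z)⁻¹ : 𝔸ˣ) : 𝔸)‖ ≤ ρ)
    (A : ι → S → 𝔸) (hA : ∀ κ z, ‖A κ z‖ ≤ a) (hdA : ∀ κ τ z, ‖covD T U κ (A τ) z‖ ≤ g) (A' : ι → S → 𝔸) :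
    ‖V₁L T U η A A'‖ ≤ CV₁ (Fintype.card ι) η ρ a g * ‖A'‖ := by
  have hC := CV₁_nonneg (Fintype.card ι) hη hρ ha hg
  refine pi_norm_le_of_forall₂ (by positivity) _ fun μ x => ?_
  have h := norm_V₁op_le T U hη hρ hU hU' A A' hA (fun κ z => norm_apply_le_pi A' κ z) hdA
    (fun κ τ z => norm_covD_le_pi T U hU hU' A' κ τ z) μ x
  refine h.trans (le_of_eq ?_)
  unfold CV₁ CF
  ring

/-- «The operator V₁ satisfies (3.73)»: `‖V₁(A)‖_{op} ≤ CV₁ d η ρ |A| |D¹A|`. [folklore] [cite: Balaban1985BackgroundPropagators, (3.73) p.405] -/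
theorem opNorm_V₁L_le {η ρ a g : ℝ} (hη : 0 ≤ η) (hρ : 1 ≤ ρ) (ha : 0 ≤ a) (hg : 0 ≤ g)
    (hU : ∀ κ z, ‖(U κ z : 𝔸)‖ ≤ ρ) (hU' : ∀ κ z, ‖(((U κ z)⁻¹ : 𝔸ˣ) : 𝔸)‖ ≤ ρ)
    (A : ι → S → 𝔸) (hA : ∀ κ z, ‖A κ z‖ ≤ a) (hdA : ∀ κ τ z, ‖covD T U κ (A τ) z‖ ≤ g) :
    ‖V₁L T U η A‖ ≤ CV₁ (Fintype.card ι) η ρ a g :=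
  ContinuousLinearMap.opNorm_le_bound _ (CV₁_nonneg (Fintype.card ι) hη hρ ha hg)
    (norm_V₁L_apply_le T U hη hρ ha hg hU hU' A hA hdA)

/-! printed scale -/

/-- (3.72), second inequality, in operator norm at the printed scale (`ρ = 1`, (3.37) on `A`):
`‖F₁(A)‖_{op} ≤ d·8e^{2α₁}(3 + 2α₁ + α₁²e^{2α₁})·α₁²·L^{−2j}` (the printed `O(1)α₁²(L^jη)⁻²`, ×`η²`). [folklore]
[cite: Balaban1985BackgroundPropagators, (3.72) p.405, (3.37) p.396] -/
theorem opNorm_F₁L_le_printed {η L α₁ a : ℝ} {j : ℕ} (hη : 0 < η) (hL : 1 ≤ L) (hα : 0 ≤ α₁)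
    (hU : ∀ κ z, ‖(U κ z : 𝔸)‖ ≤ 1) (hU' : ∀ κ z, ‖(((U κ z)⁻¹ : 𝔸ˣ) : 𝔸)‖ ≤ 1)
    (A : ι → S → 𝔸) (hA : ∀ κ z, ‖A κ z‖ ≤ a) (ha : a ≤ α₁ * (L ^ j * η)⁻¹) :
    ‖F₁L T U η A‖
      ≤ Fintype.card ι * (8 * Real.exp (2 * α₁) * (3 + 2 * α₁ + α₁ ^ 2 * Real.exp (2 * α₁))
          * α₁ ^ 2 * ((L ^ j)⁻¹) ^ 2) := by
  have hL0 : 0 < L ^ j := pow_pos (lt_of_lt_of_le one_pos hL) j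
  have hC : 0 ≤ Fintype.card ι * (8 * Real.exp (2 * α₁) * (3 + 2 * α₁ + α₁ ^ 2 * Real.exp (2 * α₁))
      * α₁ ^ 2 * ((L ^ j)⁻¹) ^ 2) := by positivity
  refine ContinuousLinearMap.opNorm_le_bound _ hC fun A' => pi_norm_le_of_forall₂ (by positivity) _ fun μ x => ?_
  have h := norm_F₁op_le_printed T U hη hL hU hU' A A' hA ha (fun κ z => norm_apply_le_pi A' κ z) μ x
  refine h.trans (le_of_eq ?_)
  ring

/-- (3.72), second inequality, for `F_{2,k}` in operator norm at the printed scale: `‖F₂(A)‖_{op} ≤ d·4e^{2α₁}(3 + 2α₁ +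
α₁²e^{2α₁})·α₁²·L^{−2j}`. [folklore] [cite: Balaban1985BackgroundPropagators, (3.72), (3.75) p.405, (3.37) p.396] -/
theorem opNorm_F₂L_le_printed {η L α₁ a : ℝ} {j : ℕ} (hη : 0 < η) (hL : 1 ≤ L) (hα : 0 ≤ α₁)
    (hU : ∀ κ z, ‖(U κ z : 𝔸)‖ ≤ 1) (hU' : ∀ κ z, ‖(((U κ z)⁻¹ : 𝔸ˣ) : 𝔸)‖ ≤ 1)
    (A : ι → S → 𝔸) (hA : ∀ κ z, ‖A κ z‖ ≤ a) (ha : a ≤ α₁ * (L ^ j * η)⁻¹) :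
    ‖F₂L T U η A‖
      ≤ Fintype.card ι * (4 * Real.exp (2 * α₁) * (3 + 2 * α₁ + α₁ ^ 2 * Real.exp (2 * α₁))
          * α₁ ^ 2 * ((L ^ j)⁻¹) ^ 2) := by
  have hL0 : 0 < L ^ j := pow_pos (lt_of_lt_of_le one_pos hL) j
  have hC : 0 ≤ Fintype.card ι * (4 * Real.exp (2 * α₁) * (3 + 2 * α₁ + α₁ ^ 2 * Real.exp (2 * α₁))
      * α₁ ^ 2 * ((L ^ j)⁻¹) ^ 2) := by positivity
  refine ContinuousLinearMap.opNorm_le_bound _ hC fun A' => pi_norm_le_of_forall₂ (by positivity) _ fun μ x => ?_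
  have h := norm_F₂op_le_printed T U hη hL hU hU' A A' hA ha (fun κ z => norm_apply_le_pi A' κ z) μ x
  refine h.trans (le_of_eq ?_)
  ring

/-- (3.73), second inequality, in operator norm at the printed scale (`|∇A′| ≤ 2|A′|` at `ρ = 1`):
`‖V₁(A)‖_{op} ≤ d·4α₁·[6L^{−j} + (1 + 2α₁e^{2α₁}(3 + 2α₁ + α₁²e^{2α₁}))L^{−2j}]` (×`η²`). [folklore]
[cite: Balaban1985BackgroundPropagators, (3.73) p.405, (3.37) p.396] -/
theorem opNorm_V₁L_le_printed {η L α₁ a g : ℝ} {j : ℕ} (hη : 0 < η) (hL : 1 ≤ L) (hα : 0 ≤ α₁)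
    (hU : ∀ κ z, ‖(U κ z : 𝔸)‖ ≤ 1) (hU' : ∀ κ z, ‖(((U κ z)⁻¹ : 𝔸ˣ) : 𝔸)‖ ≤ 1)
    (A : ι → S → 𝔸) (hA : ∀ κ z, ‖A κ z‖ ≤ a) (ha : a ≤ α₁ * (L ^ j * η)⁻¹)
    (hdA : ∀ κ τ z, ‖covD T U κ (A τ) z‖ ≤ g) (hg : g ≤ η * (α₁ * ((L ^ j * η)⁻¹) ^ 2)) :
    ‖V₁L T U η A‖
      ≤ Fintype.card ι * (4 * α₁ * (6 * (L ^ j)⁻¹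
          + (1 + 2 * α₁ * Real.exp (2 * α₁) * (3 + 2 * α₁ + α₁ ^ 2 * Real.exp (2 * α₁))) * ((L ^ j)⁻¹) ^ 2)) := by
  have hL0 : 0 < L ^ j := pow_pos (lt_of_lt_of_le one_pos hL) j
  have hC : 0 ≤ Fintype.card ι * (4 * α₁ * (6 * (L ^ j)⁻¹
      + (1 + 2 * α₁ * Real.exp (2 * α₁) * (3 + 2 * α₁ + α₁ ^ 2 * Real.exp (2 * α₁))) * ((L ^ j)⁻¹) ^ 2)) := by
    positivity
  refine ContinuousLinearMap.opNorm_le_bound _ hC fun A' => pi_norm_le_of_forall₂ (by positivity) _ fun μ x => ?_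
  have h2 : ∀ κ τ z, ‖covD T U κ (A' τ) z‖ ≤ 2 * ‖A'‖ := fun κ τ z =>
    (norm_covD_le_pi T U hU hU' A' κ τ z).trans (le_of_eq (by ring))
  have h := norm_V₁op_le_printed T U hη hL hU hU' A A' hA ha (fun κ z => norm_apply_le_pi A' κ z) hdA hg h2 μ x
  refine h.trans (le_of_eq ?_)
  ring

/-- (3.73), second inequality, for `V₂` in operator norm at the printed scale:
`‖V₂(A)‖_{op} ≤ d·α₁·[16L^{−j} + (6 + 4α₁e^{2α₁}(3 + 2α₁ + α₁²e^{2α₁}))L^{−2j}]` (×`η²`). [folklore]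
[cite: Balaban1985BackgroundPropagators, (3.73), (3.75) p.405, (3.37) p.396] -/
theorem opNorm_V₂L_le_printed {η L α₁ a g : ℝ} {j : ℕ} (hη : 0 < η) (hL : 1 ≤ L) (hα : 0 ≤ α₁)
    (hU : ∀ κ z, ‖(U κ z : 𝔸)‖ ≤ 1) (hU' : ∀ κ z, ‖(((U κ z)⁻¹ : 𝔸ˣ) : 𝔸)‖ ≤ 1)
    (A : ι → S → 𝔸) (hA : ∀ κ z, ‖A κ z‖ ≤ a) (ha : a ≤ α₁ * (L ^ j * η)⁻¹)
    (hdA : ∀ κ τ z, ‖covD T U κ (A τ) z‖ ≤ g) (hg : g ≤ η * (α₁ * ((L ^ j * η)⁻¹) ^ 2)) :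
    ‖V₂L T U η A‖
      ≤ Fintype.card ι * (α₁ * (16 * (L ^ j)⁻¹
          + (6 + 4 * α₁ * Real.exp (2 * α₁) * (3 + 2 * α₁ + α₁ ^ 2 * Real.exp (2 * α₁))) * ((L ^ j)⁻¹) ^ 2)) := by
  have hL0 : 0 < L ^ j := pow_pos (lt_of_lt_of_le one_pos hL) j
  have hC : 0 ≤ Fintype.card ι * (α₁ * (16 * (L ^ j)⁻¹
      + (6 + 4 * α₁ * Real.exp (2 * α₁) * (3 + 2 * α₁ + α₁ ^ 2 * Real.exp (2 * α₁))) * ((L ^ j)⁻¹) ^ 2)) := by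
    positivity
  refine ContinuousLinearMap.opNorm_le_bound _ hC fun A' => pi_norm_le_of_forall₂ (by positivity) _ fun μ x => ?_
  have h2 : ∀ κ τ z, ‖covD T U κ (A' τ) z‖ ≤ 2 * ‖A'‖ := fun κ τ z =>
    (norm_covD_le_pi T U hU hU' A' κ τ z).trans (le_of_eq (by ring))
  have h := norm_V₂op_le_printed T U hη hL hU hU' A A' hA ha (fun κ z => norm_apply_le_pi A' κ z) hdA hg h2 μ x
  refine h.trans (le_of_eq ?_)
  ring

end OperatorNorm


section Examples

variable {𝔸 : Type*} [NormedRing 𝔸] [NormedAlgebra ℂ 𝔸] [CompleteSpace 𝔸] {S : Type*} {ι : Type*} [Fintype ι]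
variable (T : ι → Equiv.Perm S) (U : ι → S → 𝔸ˣ)

/-- «operator»: `V₂(A)` is additive in its argument — now a one-liner from the packaging. -/
example (η : ℝ) (A A' B' : ι → S → 𝔸) : V₂L T U η A (A' + B') = V₂L T U η A A' + V₂L T U η A B' := map_add _ _ _

/-- (3.71) applied to a vector field, read off the operator identity `lapDDL_prodCfg`. -/
example (η : ℝ) (A A' : ι → S → 𝔸) : lapDDL T (prodCfg U η A) A' = lapDD T U A' - V₁op T U η A A' := by
  rw [lapDDL_prodCfg, FunLike.coe_sub, Pi.sub_apply, lapDDL_apply, V₁L_apply]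

/-- «bounded»: the operator-norm form of (3.72) consumed as `‖F₂(A)A′‖ ≤ ‖F₂(A)‖·‖A′‖ ≤ CF 4 d η ρ a·‖A′‖` on a finite lattice. -/
example [Fintype S] {η ρ a : ℝ} (hη : 0 ≤ η) (hρ : 1 ≤ ρ) (ha : 0 ≤ a)
    (hU : ∀ κ z, ‖(U κ z : 𝔸)‖ ≤ ρ) (hU' : ∀ κ z, ‖(((U κ z)⁻¹ : 𝔸ˣ) : 𝔸)‖ ≤ ρ)
    (A : ι → S → 𝔸) (hA : ∀ κ z, ‖A κ z‖ ≤ a) (A' : ι → S → 𝔸) :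
    ‖F₂L T U η A A'‖ ≤ CF 4 (Fintype.card ι) η ρ a * ‖A'‖ :=
  (F₂L T U η A).le_of_opNorm_le (opNorm_F₂L_le T U hη hρ ha hU hU' A hA) A'

/-- at `A = 0` the perturbation vanishes as an operator. -/
example (η : ℝ) (A' : ι → S → 𝔸) : V₂L T U η 0 A' = 0 := by
  rw [V₂L_zero, FunLike.coe_zero, Pi.zero_apply]

end Examples

end Literature.MathematicalPhysics.QuantumFieldTheory.Balaban1983to89.B9Eq372Operator

end
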